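import Summits.Parity.GeneralizedHardyLittlewood.Theorems.PrimeLevelFamEdgeIdeaDeltasSliverDefs
import Mathlib.Analysis.Complex.AbsMax
import Mathlib.Analysis.Complex.ReImTopology
import Mathlib.Analysis.SpecialFunctions.Pow.Real
import Mathlib.Analysis.SpecialFunctions.ExpDeriv

/-!
# Route `PrimeLevelFamEdge` — card K6-4 «THREE LINES ACROSS THE DIAGONAL»: the box transport is a
# THEOREM (deck 6's `ThreeLinesTransport w₀ B` holds for every `w₀ ≥ 0`)

PROOF-KIND file (cell ls-idea, typer gen 1): no new definition, no named fact. Deck 6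
(`PrimeLevelFamEdgeIdeaDeltasSliverDefs.lean` §3, p565944) typed card K6-4's pipeline as
(S) `AnchorEdge` + (T) `TrivialOnBox` + (N) `NormalBeyond` + (R) `RealisesLogWindow` + the pure
complex-analysis shape `ThreeLinesTransport w₀ B`, and proved the composition
`logWindowUpperControl_of_threeLines` GIVEN the transport as a hypothesis. This file DISCHARGES the
transport: `threeLinesTransport_holds : 0 ≤ w₀ → ThreeLinesTransport w₀ B`, by the maximum modulus
principle on the open box `(−w₀, B+1) × (−W_q, W_q)` (Mathlib
`Complex.norm_le_of_forall_mem_frontier_norm_le`) applied to the damped, tilted function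
`F(w) = G_q(w) · exp(ε_q (w − t)² + aL·(1 − φ(w)) − (log C₊)·φ(w))`, `φ(w) = (w + w₀)/D`,
`D = B + 1 + w₀`, `L = log log q̂`, `a L = −log a_q`, `C₊ = max C 1`, with the card's damping
`ε_q = L³/log² q̂` (so `ε_q W_q² = c₁² L` beats the horizontal-edge loss `(c₂ + a) L`, and
`ε_q D² ≤ 1` once `log q̂ ≥ 64 D⁴`), giving `|G_q(t)| ≤ e · C₊ · (log q̂)^{−a/D} → 0`. Hence the
end-to-end statement `logWindowUpperControl_of_threeLines_holds`: (S) + (T) + (N) + (R) ⇒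
`LogWindowUpperControl B η` for every `η < 4`, `B > 0`, `w₀ ≥ 0`, `0 < a`, `c₂ + a < c₁²` — the
card's bookkeeping is now ENTIRELY kernel-checked; what remains open is exactly its analytic content
(the anchor's δ-uniformity F2 = acq-13313, the normality crux (N), and the smoothed-vs-sharp
realisation (R)). «typed ≠ proved for those; no exceptional-zero theorem (no Landau–Siegel exclusion,
no Theorem 1–2 of arXiv:2211.02515, no repaired Margin232) is proved here». Filed
`--supports stmt-Parity-20007 --as helper`.
-/

noncomputable section

namespace Summit.Parity.GeneralizedHardyLittlewood.Theorems.PrimeLevelFamEdgeIdeaDeltas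

open Complex Set
open Literature.NumberTheory.LFunctions.KMV2000

/-- The damped three-lines exponent (bookkeeping): the real part of
`E(w) = ε (w−t)² + aL·(1 − (w+w₀)·D⁻¹) − lc·(w+w₀)·D⁻¹` for real `ε, t, aL, w₀, D⁻¹, lc`.
[cite: KowalskiMichelVanderKam2000, p. 28 L73–L77 (the window the transport crosses)] -/
theorem re_dampedExponent (εq t aL w₀ Dinv lc : ℝ) (w : ℂ) :
    ((εq : ℂ) * ((w - t) * (w - t)) + (aL : ℂ) * (1 - (w + w₀) * (Dinv : ℂ)) -
        (lc : ℂ) * ((w + w₀) * (Dinv : ℂ))).re =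
      εq * ((w.re - t) ^ 2 - w.im ^ 2) + aL * (1 - (w.re + w₀) * Dinv) -
        lc * ((w.re + w₀) * Dinv) := by
  simp only [add_re, sub_re, mul_re, mul_im, add_im, sub_im, ofReal_re, ofReal_im, one_re]
  ring

/-- Elementary growth bookkeeping for the damping `ε_q = (log ℓ)³/ℓ²`: `(log ℓ)³ · D² ≤ ℓ²` once
`ℓ ≥ 64 D⁴` (`D ≥ 1`), from Mathlib's `Real.log_le_rpow_div` (`log ℓ ≤ 2 ℓ^{1/2}`).
[cite: KowalskiMichelVanderKam2000, p. 28 L73–L77] -/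
theorem log_cube_mul_sq_le {ℓ D : ℝ} (hD : 1 ≤ D) (hℓ : 64 * D ^ 4 ≤ ℓ) :
    Real.log ℓ ^ 3 * D ^ 2 ≤ ℓ ^ 2 := by
  have hD4 : 1 ≤ D ^ 4 := one_le_pow₀ hD
  have hℓ1 : 1 ≤ ℓ := by linarith
  have hℓpos : 0 < ℓ := by linarith
  have hL : Real.log ℓ ≤ 2 * ℓ ^ (1 / 2 : ℝ) := by
    have := Real.log_le_rpow_div hℓpos.le (by norm_num : (0 : ℝ) < 1 / 2)
    linarith
  obtain ⟨s, hs⟩ : ∃ s : ℝ, s = ℓ ^ (1 / 2 : ℝ) := ⟨_, rfl⟩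
  rw [← hs] at hL
  have hs0 : 0 ≤ s := by rw [hs]; exact Real.rpow_nonneg hℓpos.le _
  have hs2 : s ^ 2 = ℓ := by
    rw [hs, ← Real.rpow_natCast, ← Real.rpow_mul hℓpos.le]; norm_num
  have hs4 : s ^ 4 = ℓ ^ 2 := by rw [← hs2]; ring
  have h64 : (8 * D ^ 2) ^ 2 = 64 * D ^ 4 := by ring
  have h8 : 8 * D ^ 2 ≤ s :=
    (pow_le_pow_iff_left₀ (by positivity) hs0 two_ne_zero).1 (by rw [hs2, h64]; exact hℓ)
  have hlog0 : 0 ≤ Real.log ℓ := Real.log_nonneg hℓ1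
  calc Real.log ℓ ^ 3 * D ^ 2 ≤ (2 * s) ^ 3 * D ^ 2 := by gcongr
    _ = s ^ 3 * (8 * D ^ 2) := by ring
    _ ≤ s ^ 3 * s := by gcongr
    _ = ℓ ^ 2 := by rw [← hs4]; ring

/-- **K6-4: the THREE-LINES TRANSPORT on the box HOLDS** (deck 6's `ThreeLinesTransport w₀ B`, every
`w₀ ≥ 0`, every `B`). For each family of entire `G q` with (S) anchor `‖G q‖ ≤ (log q̂)^{−a}` on
`Re w = −w₀`, (T) `‖G q‖ ≤ (log q̂)^{c₂}` on the box, (N) `‖G q‖ ≤ C` on `Re w = B+1`, box height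
`W_q = c₁ log q̂/log log q̂`, `0 < a`, `c₂ + a < c₁²`, `0 < c₁`: `‖G q t‖ → 0` along the primes for
each real `t ∈ [0, B]`. Maximum modulus (Mathlib `Complex.norm_le_of_forall_mem_frontier_norm_le`)
for `F = G_q · exp(ε_q(w−t)² + aL(1−φ) − log C₊·φ)` on the open box; boundary bound `exp(ε_q D²)`;
at `w = t`: `‖G q t‖ ≤ e · C₊ · exp(−(a/D)·L) ≤ ε` for `log q̂` beyond an explicit threshold.
[cite: KowalskiMichelVanderKam2000, p. 28 L73–L77] -/
theorem threeLinesTransport_holds {w₀ B : ℝ} (hw₀ : 0 ≤ w₀) : ThreeLinesTransport w₀ B := by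
  intro G a c₂ C c₁ ha hc hc₁ hG hS hT hN t ht0 htB ε hε
  obtain ⟨q₁, h₁⟩ := hS
  obtain ⟨q₂, h₂⟩ := hT
  obtain ⟨q₃, h₃⟩ := hN
  -- constants of the box
  obtain ⟨D, hD⟩ : ∃ x : ℝ, x = B + 1 + w₀ := ⟨_, rfl⟩
  have hD1 : 1 ≤ D := by rw [hD]; linarith
  have hDpos : 0 < D := by linarith
  obtain ⟨Dinv, hDinv⟩ : ∃ x : ℝ, x = D⁻¹ := ⟨_, rfl⟩
  have hDDinv : D * Dinv = 1 := by rw [hDinv, mul_inv_cancel₀ hDpos.ne']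
  have hDinv0 : 0 ≤ Dinv := by rw [hDinv]; positivity
  obtain ⟨Cp, hCp⟩ : ∃ x : ℝ, x = max C 1 := ⟨_, rfl⟩
  have hCp1 : 1 ≤ Cp := by rw [hCp]; exact le_max_right _ _
  have hCCp : C ≤ Cp := by rw [hCp]; exact le_max_left _ _
  have hCppos : 0 < Cp := by linarith
  obtain ⟨lc, hlc⟩ : ∃ x : ℝ, x = Real.log Cp := ⟨_, rfl⟩
  have hlc0 : 0 ≤ lc := by rw [hlc]; exact Real.log_nonneg hCp1
  have hexplc : Real.exp lc = Cp := by rw [hlc, Real.exp_log hCppos]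
  obtain ⟨θ, hθ⟩ : ∃ x : ℝ, x = (t + w₀) * Dinv := ⟨_, rfl⟩
  have hθ0 : 0 ≤ θ := by rw [hθ]; positivity
  have hθ1 : θ ≤ 1 := by
    rw [hθ, ← hDDinv]
    exact mul_le_mul_of_nonneg_right (by rw [hD]; linarith) hDinv0
  have h1θ : Dinv ≤ 1 - θ := by
    have e1 : θ + Dinv = (t + w₀ + 1) * Dinv := by rw [hθ]; ring
    have e2 : (t + w₀ + 1) * Dinv ≤ D * Dinv :=
      mul_le_mul_of_nonneg_right (by rw [hD]; linarith) hDinv0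
    linarith
  -- threshold in `ℓ = log q̂`
  obtain ⟨L₀, hL₀⟩ : ∃ x : ℝ, x = D / a * Real.log (Real.exp 1 * Cp / ε) := ⟨_, rfl⟩
  obtain ⟨N, hN⟩ := exists_log_qhat_ge (max (max 2 (64 * D ^ 4)) (Real.exp L₀))
  refine ⟨max (max q₁ q₂) (max q₃ N), fun q hq hqge ↦ ?_⟩
  haveI : NeZero q := ⟨hq.ne_zero⟩
  have hq₁ : q₁ ≤ q := le_trans (le_trans (le_max_left _ _) (le_max_left _ _)) hqge
  have hq₂ : q₂ ≤ q := le_trans (le_trans (le_max_right _ _) (le_max_left _ _)) hqge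
  have hq₃ : q₃ ≤ q := le_trans (le_trans (le_max_left _ _) (le_max_right _ _)) hqge
  have hqN : N ≤ q := le_trans (le_trans (le_max_right _ _) (le_max_right _ _)) hqge
  obtain ⟨ℓ, hℓ⟩ : ∃ x : ℝ, x = Real.log (qhat q) := ⟨_, rfl⟩
  have hNq : max (max 2 (64 * D ^ 4)) (Real.exp L₀) ≤ ℓ := by rw [hℓ]; exact hN q hqN
  have hℓ2 : 2 ≤ ℓ := le_trans (le_trans (le_max_left _ _) (le_max_left _ _)) hNq
  have hℓ64 : 64 * D ^ 4 ≤ ℓ := le_trans (le_trans (le_max_right _ _) (le_max_left _ _)) hNq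
  have hℓL₀ : Real.exp L₀ ≤ ℓ := le_trans (le_max_right _ _) hNq
  have hℓpos : 0 < ℓ := by linarith
  obtain ⟨L, hL⟩ : ∃ x : ℝ, x = Real.log ℓ := ⟨_, rfl⟩
  have hLpos : 0 < L := by rw [hL]; exact Real.log_pos (by linarith)
  have hLL₀ : L₀ ≤ L := by
    have := Real.log_le_log (Real.exp_pos L₀) hℓL₀
    rwa [Real.log_exp, ← hL] at this
  -- the box height and the damping
  obtain ⟨W, hW⟩ : ∃ x : ℝ, x = boxHeight c₁ q := ⟨_, rfl⟩
  have hW' : W = c₁ * ℓ / L := by rw [hW, boxHeight, ← hℓ, ← hL]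
  have hWpos : 0 < W := by rw [hW']; positivity
  obtain ⟨εq, hεq⟩ : ∃ x : ℝ, x = L ^ 3 / ℓ ^ 2 := ⟨_, rfl⟩
  have hεqpos : 0 < εq := by rw [hεq]; positivity
  have hεW : εq * W ^ 2 = c₁ ^ 2 * L := by
    rw [hεq, hW']
    field_simp
  have hεD : εq * D ^ 2 ≤ 1 := by
    rw [hεq, hL, div_mul_eq_mul_div, div_le_one (by positivity)]
    exact log_cube_mul_sq_le hD1 hℓ64
  obtain ⟨aL, haL⟩ : ∃ x : ℝ, x = a * L := ⟨_, rfl⟩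
  have haL0 : 0 ≤ aL := by rw [haL]; positivity
  -- rpow bookkeeping: `ℓ^x = exp (x L)`
  have hrpow : ∀ x : ℝ, Real.log (qhat q) ^ x = Real.exp (x * L) := fun x ↦ by
    rw [← hℓ, Real.rpow_def_of_pos hℓpos, ← hL, mul_comm]
  -- the auxiliary entire function
  obtain ⟨E, hE⟩ : ∃ E : ℂ → ℂ, E = fun w ↦ (εq : ℂ) * ((w - t) * (w - t)) +
      (aL : ℂ) * (1 - (w + w₀) * (Dinv : ℂ)) - (lc : ℂ) * ((w + w₀) * (Dinv : ℂ)) := ⟨_, rfl⟩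
  obtain ⟨F, hF⟩ : ∃ F : ℂ → ℂ, F = fun w ↦ G q w * Complex.exp (E w) := ⟨_, rfl⟩
  have hEre : ∀ w : ℂ, (E w).re = εq * ((w.re - t) ^ 2 - w.im ^ 2) +
      aL * (1 - (w.re + w₀) * Dinv) - lc * ((w.re + w₀) * Dinv) := fun w ↦ by
    rw [hE]; exact re_dampedExponent εq t aL w₀ Dinv lc w
  have hFnorm : ∀ w : ℂ, ‖F w‖ = ‖G q w‖ * Real.exp ((E w).re) := fun w ↦ by
    rw [hF]; simp only [norm_mul, Complex.norm_exp]
  have hEdiff : Differentiable ℂ E := by rw [hE]; fun_prop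
  have hFdiff : Differentiable ℂ F := by rw [hF]; exact (hG q).mul hEdiff.cexp
  -- the open box and its closure
  obtain ⟨U, hU⟩ : ∃ U : Set ℂ, U = (Ioo (-w₀) (B + 1)) ×ℂ (Ioo (-W) W) := ⟨_, rfl⟩
  have hUo : IsOpen U := by rw [hU]; exact isOpen_Ioo.reProdIm isOpen_Ioo
  have hUb : Bornology.IsBounded U := by
    rw [hU]; exact (Metric.isBounded_Ioo _ _).reProdIm (Metric.isBounded_Ioo _ _)
  have hUcl : closure U = (Icc (-w₀) (B + 1)) ×ℂ (Icc (-W) W) := by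
    rw [hU, closure_reProdIm, closure_Ioo (by linarith : (-w₀ : ℝ) < B + 1).ne,
      closure_Ioo (by linarith : (-W : ℝ) < W).ne]
  -- geometric fact on the closed box
  have hsq_le : ∀ x : ℝ, -w₀ ≤ x → x ≤ B + 1 → (x - t) ^ 2 ≤ D ^ 2 := fun x hx1 hx2 ↦
    sq_le_sq' (by rw [hD]; linarith) (by rw [hD]; linarith)
  -- boundary bound
  have hfront : ∀ z ∈ frontier U, ‖F z‖ ≤ Real.exp (εq * D ^ 2) := by
    intro z hz
    have hzcl : z ∈ closure U := frontier_subset_closure hz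
    have hzU : z ∉ U := by
      have : z ∉ interior U := hz.2
      rwa [hUo.interior_eq] at this
    rw [hUcl, mem_reProdIm] at hzcl
    obtain ⟨⟨hre1, hre2⟩, ⟨him1, him2⟩⟩ := hzcl
    have hzim : |z.im| ≤ W := abs_le.2 ⟨him1, him2⟩
    have hzimW : |z.im| ≤ boxHeight c₁ q := by rw [← hW]; exact hzim
    have hφ0 : 0 ≤ (z.re + w₀) * Dinv := mul_nonneg (by linarith) hDinv0
    have hsq := mul_le_mul_of_nonneg_left (hsq_le z.re hre1 hre2) hεqpos.le
    have him0 : 0 ≤ εq * z.im ^ 2 := mul_nonneg hεqpos.le (sq_nonneg _)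
    rw [hU, mem_reProdIm, not_and_or] at hzU
    rw [hFnorm z, hEre z]
    rcases hzU with hre' | him'
    · -- vertical edges
      simp only [mem_Ioo, not_and_or, not_lt] at hre'
      rcases hre' with hl | hr
      · -- LEFT edge `Re z = −w₀`: anchor `‖G‖ ≤ ℓ^{−a} = exp(−aL)`
        have hzre : z.re = -w₀ := le_antisymm hl hre1
        have hGz : ‖G q z‖ ≤ Real.exp (-a * L) := by
          have := h₁ q hq hq₁ z hzre hzimW
          rwa [hrpow] at this
        have h0 : (z.re + w₀) * Dinv = 0 := by rw [hzre]; ring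
        have hEz : εq * ((z.re - t) ^ 2 - z.im ^ 2) + aL * (1 - (z.re + w₀) * Dinv) -
            lc * ((z.re + w₀) * Dinv) ≤ εq * D ^ 2 + aL := by
          rw [h0, mul_sub]
          linarith
        calc ‖G q z‖ * Real.exp _ ≤ Real.exp (-a * L) * Real.exp (εq * D ^ 2 + aL) :=
              mul_le_mul hGz (Real.exp_le_exp.2 hEz) (Real.exp_pos _).le (Real.exp_pos _).le
          _ = Real.exp (εq * D ^ 2) := by
              rw [← Real.exp_add]
              congr 1
              rw [haL]; ring
      · -- RIGHT edge `Re z = B + 1`: normality `‖G‖ ≤ C ≤ Cp = exp lc`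
        have hzre : z.re = B + 1 := le_antisymm hre2 hr
        have hGz : ‖G q z‖ ≤ Real.exp lc := by
          rw [hexplc]
          exact (h₃ q hq hq₃ z hzre hzimW).trans hCCp
        have h1 : (z.re + w₀) * Dinv = 1 := by rw [hzre, ← hD, hDDinv]
        have hEz : εq * ((z.re - t) ^ 2 - z.im ^ 2) + aL * (1 - (z.re + w₀) * Dinv) -
            lc * ((z.re + w₀) * Dinv) ≤ εq * D ^ 2 - lc := by
          rw [h1, mul_sub]
          linarith
        calc ‖G q z‖ * Real.exp _ ≤ Real.exp lc * Real.exp (εq * D ^ 2 - lc) :=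
              mul_le_mul hGz (Real.exp_le_exp.2 hEz) (Real.exp_pos _).le (Real.exp_pos _).le
          _ = Real.exp (εq * D ^ 2) := by
              rw [← Real.exp_add]
              congr 1
              ring
    · -- HORIZONTAL edges `|Im z| = W`: trivial bound `‖G‖ ≤ ℓ^{c₂} = exp(c₂ L)` and damping
      simp only [mem_Ioo, not_and_or, not_lt] at him'
      have hzim2 : z.im ^ 2 = W ^ 2 := by
        rcases him' with h | h
        · have e : z.im = -W := le_antisymm h him1
          rw [e]; ring
        · have e : z.im = W := le_antisymm him2 h
          rw [e]
      have hGz : ‖G q z‖ ≤ Real.exp (c₂ * L) := by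
        have := h₂ q hq hq₂ z hre1 hre2 hzimW
        rwa [hrpow] at this
      have e0 : εq * ((z.re - t) ^ 2 - W ^ 2) = εq * (z.re - t) ^ 2 - c₁ ^ 2 * L := by
        rw [mul_sub, hεW]
      have e3 : 0 ≤ aL * ((z.re + w₀) * Dinv) := mul_nonneg haL0 hφ0
      have e4 : 0 ≤ lc * ((z.re + w₀) * Dinv) := mul_nonneg hlc0 hφ0
      have hEz : εq * ((z.re - t) ^ 2 - z.im ^ 2) + aL * (1 - (z.re + w₀) * Dinv) -
          lc * ((z.re + w₀) * Dinv) ≤ εq * D ^ 2 - c₁ ^ 2 * L + aL := by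
        rw [hzim2, e0, mul_sub, mul_one]
        linarith
      have hneg : 0 ≤ (c₁ ^ 2 - (c₂ + a)) * L := mul_nonneg (by linarith) hLpos.le
      calc ‖G q z‖ * Real.exp _ ≤ Real.exp (c₂ * L) * Real.exp (εq * D ^ 2 - c₁ ^ 2 * L + aL) :=
            mul_le_mul hGz (Real.exp_le_exp.2 hEz) (Real.exp_pos _).le (Real.exp_pos _).le
        _ = Real.exp (εq * D ^ 2 - (c₁ ^ 2 - (c₂ + a)) * L) := by
            rw [← Real.exp_add]
            congr 1
            rw [haL]; ring
        _ ≤ Real.exp (εq * D ^ 2) := by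
            rw [Real.exp_le_exp]
            linarith
  -- maximum modulus at the real point `t`
  have htcl : (t : ℂ) ∈ closure U := by
    rw [hUcl, mem_reProdIm, Complex.ofReal_re, Complex.ofReal_im]
    exact ⟨⟨by linarith, by linarith⟩, ⟨by linarith, hWpos.le⟩⟩
  have hmax := Complex.norm_le_of_forall_mem_frontier_norm_le hUb hFdiff.diffContOnCl hfront htcl
  -- unpack: `‖F t‖ = ‖G q t‖ · exp(aL(1−θ) − lc θ)`
  have hEt : (E (t : ℂ)).re = aL * (1 - θ) - lc * θ := by
    rw [hEre, Complex.ofReal_re, Complex.ofReal_im, ← hθ]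
    ring
  rw [hFnorm, hEt] at hmax
  have hXpos := Real.exp_pos (aL * (1 - θ) - lc * θ)
  have hGt : ‖G q (t : ℂ)‖ ≤ Real.exp (εq * D ^ 2) * Real.exp (lc * θ - aL * (1 - θ)) := by
    have h := (le_div_iff₀ hXpos).2 hmax
    rwa [div_eq_mul_inv, ← Real.exp_neg,
      show -(aL * (1 - θ) - lc * θ) = lc * θ - aL * (1 - θ) by ring] at h
  -- `exp(lc θ − aL(1−θ)) ≤ Cp · exp(−(a/D)·L)` and the threshold `L ≥ L₀`
  have hexp2 : Real.exp (lc * θ - aL * (1 - θ)) ≤ Cp * Real.exp (-(aL * Dinv)) := by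
    rw [← hexplc, ← Real.exp_add, Real.exp_le_exp]
    have e1 : lc * θ ≤ lc := mul_le_of_le_one_right hlc0 hθ1
    have e2 : aL * Dinv ≤ aL * (1 - θ) := mul_le_mul_of_nonneg_left h1θ haL0
    linarith
  have hexp3 : Real.exp (-(aL * Dinv)) ≤ ε / (Real.exp 1 * Cp) := by
    have hpos : 0 < Real.exp 1 * Cp / ε := by positivity
    have hane : a ≠ 0 := ha.ne'
    have hDne : D ≠ 0 := hDpos.ne'
    have hlog : Real.log (Real.exp 1 * Cp / ε) ≤ aL * Dinv := by
      have e1 : a * L₀ * Dinv = Real.log (Real.exp 1 * Cp / ε) := by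
        rw [hL₀, hDinv]
        field_simp
      rw [← e1, haL]
      exact mul_le_mul_of_nonneg_right (mul_le_mul_of_nonneg_left hLL₀ ha.le) hDinv0
    calc Real.exp (-(aL * Dinv)) ≤ Real.exp (-Real.log (Real.exp 1 * Cp / ε)) := by
          rw [Real.exp_le_exp]; linarith
      _ = ε / (Real.exp 1 * Cp) := by
          rw [Real.exp_neg, Real.exp_log hpos, inv_div]
  calc ‖G q (t : ℂ)‖ ≤ Real.exp (εq * D ^ 2) * Real.exp (lc * θ - aL * (1 - θ)) := hGt
    _ ≤ Real.exp 1 * (Cp * (ε / (Real.exp 1 * Cp))) :=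
        mul_le_mul (Real.exp_le_exp.2 hεD)
          (hexp2.trans (mul_le_mul_of_nonneg_left hexp3 hCppos.le))
          (Real.exp_pos _).le (Real.exp_pos _).le
    _ = ε := by
        field_simp

/-- **K6-4 end-to-end, transport DISCHARGED: (S) + (T) + (N) + realisation ⇒ K6-1's one-sided
log-window door `LogWindowUpperControl B η`** for every `η < 4`, `0 < B`, `0 ≤ w₀`, `0 < a`,
`c₂ + a < c₁²`, `0 < c₁` (deck 6's `logWindowUpperControl_of_threeLines` with its transport
hypothesis supplied by `threeLinesTransport_holds`). The remaining hypotheses are exactly the card's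
analytic content: the anchor (S) with its δ-uniformity, the trivial bound (T), the NORMALITY CRUX (N),
and the smoothed-vs-sharp realisation (R); nothing about them is asserted here.
[cite: KowalskiMichelVanderKam2000, §6 p. 19 and p. 28 L73–L77] -/
theorem logWindowUpperControl_of_threeLines_holds {G : ℕ → ℂ → ℂ} {w₀ B a c₂ C c₁ η : ℝ}
    (hw₀ : 0 ≤ w₀) (hB : 0 < B) (hη : η < 4) (ha : 0 < a) (hc : c₂ + a < c₁ ^ 2) (hc₁ : 0 < c₁)
    (hG : ∀ q : ℕ, Differentiable ℂ (G q)) (hS : AnchorEdge G w₀ a c₁)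
    (hTr : TrivialOnBox G w₀ B c₂ c₁) (hN : NormalBeyond G B C c₁) (hR : RealisesLogWindow G B) :
    LogWindowUpperControl B η :=
  logWindowUpperControl_of_threeLines (threeLinesTransport_holds hw₀) hB hη ha hc hc₁ hG hS hTr hN hR

end Summit.Parity.GeneralizedHardyLittlewood.Theorems.PrimeLevelFamEdgeIdeaDeltas
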